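import Summits.HodgeConjecture.HodgeConjecture.Theses.MirrorBraneLift
import HarnessLib

/-!
# Assembly of route `MirrorBraneLift` (stmt-HodgeConjecture-18682)

The assembly item of route `MirrorBraneLift` is, verbatim, the curried form of the route file's deciding
theorem `closes` (sorry-free in `Theses/MirrorBraneLift.lean`); this file records it as a theorem so the
item closes. No mathematics beyond the route file's own `closes`.
-/

set_option linter.dupNamespace false

namespace Summit.HodgeConjecture.HodgeConjecture.Theorems

/-- **Assembly of route `MirrorBraneLift`** (item stmt-HodgeConjecture-18682): the route's cruxes and
supports imply the summit statement exactly as composed by the route file's deciding theorem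
`Summit.HodgeConjecture.HodgeConjecture.Theses.MirrorBraneLift.closes`, of which this is the curried
restatement. -/
theorem mirrorBraneLift_assembly_proof :
    Summit.HodgeConjecture.HodgeConjecture.Theses.MirrorBraneLift.Assembly :=
  -- buildfix 2026-08-20 (proof only; statement byte-identical): since the 08-17 route repair the
  -- deciding theorem `closes` takes the RESTATED cruxes `LagrangianLiftR` (extra cell-intersection
  -- hypothesis, hence implied by `LagrangianLift` by dropping it) and `MirrorRealizationR`
  -- (`TropicalWeilSupply → LagrangianLiftR → OneAlgebraicWeilClass`, supplied here from
  -- `h₃ : MirrorRealization` fed with `h₂ : LagrangianLift` itself).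
  fun h₁ h₂ h₃ h₄ h₅ h₆ ↦
    Summit.HodgeConjecture.HodgeConjecture.Theses.MirrorBraneLift.closes h₁
      (fun n hn δ hδ P V _ ↦ h₂ n hn δ hδ P V) (fun hT _ ↦ h₃ hT h₂) h₄ h₅ h₆

end Summit.HodgeConjecture.HodgeConjecture.Theorems
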